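import Literature.Computability.Cryptography.LWEPrimePowerTopDigits
import HarnessLib

/-!
# The top solver's specification restricted to full-column-rank systems (MP12, Thm. 3.1)

Topic `Computability/Cryptography` (LWE), grouping namespace `LWE.MP12`, a small sequel of
`LWEPrimePowerTopDigits.lean` (`IsTopSolver`, `recoverTop`, `TopGood`, `recoverTop_eq_of_topGood`).
Proved material (no named fact) towards
`Literature.Computability.Cryptography.blprs_gapSVP_sqrt_dim_to_lwe_classical` (**pqc.S21**),
component Thm. 2.17 = Micciancio–Peikert 2012, Thm. 3.1: the specification `IsTopSolver` asks the
solver of the top system `pᵃ⟨aₖ, t⟩ = rₖ` to return a solution whenever one exists; the machine's solver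
(Hensel lifting over `ℤ_{2ᵉ}` with `GF(2)` solves, `LWEPrimePowerLift.lean`) is only guaranteed to do
so when the coefficient matrix has full column rank mod `p` — which is part of the good event
`TopGood`, the only place the specification is used. This file records the restricted specification
`IsTopSolverFR` and re-proves `recoverTop_eq_of_topGood` from it.

## References

* D. Micciancio, C. Peikert, *Trapdoors for lattices: simpler, tighter, faster, smaller*, EUROCRYPT 2012,
  LNCS 7237; full version IACR ePrint 2011/501, §3, proof of Thm. 3.1, p. 16. [MicciancioPeikert2012]
-/

noncomputable section

namespace Literature.Computability.Cryptography

namespace LWE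

namespace MP12

/-! ### The top solver's specification restricted to full-rank systems -/

section TopFR

variable {n : ℕ} {p : ℕ} [hp : Fact p.Prime] {e : ℕ} (a : ℕ) {m' : ℕ}

/-- **The specification the machine's lifting solver meets**: whenever the coefficient matrix has full
column rank mod `p` AND the system `pᵃ⟨aₖ, t'⟩ = rₖ` has a solution, the solver returns `pᵃ·t'` for some
solution `t'` (nothing is asked of rank-deficient systems, where Hensel lifting may fail).
[cite: MicciancioPeikert2012, Thm. 3.1 proof (p. 16: "solve for `s` by Gaussian elimination")] -/
def IsTopSolverFR (he : 0 < e)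
    (F : (Fin m' → (Fin n → ZMod (p ^ e)) × ZMod (p ^ e)) → (Fin m' → ZMod (p ^ e)) → (Fin n → ZMod (p ^ e))) : Prop :=
  ∀ S r, FullRankModP p (dvd_pow_self p he.ne') (fun k => (S k).1) →
    (∃ t : Fin n → ZMod (p ^ e), ∀ k, (p : ZMod (p ^ e)) ^ a * ((S k).1 ⬝ᵥ t) = r k) →
    ∃ t : Fin n → ZMod (p ^ e), (∀ k, (p : ZMod (p ^ e)) ^ a * ((S k).1 ⬝ᵥ t) = r k) ∧ F S r = (p : ZMod (p ^ e)) ^ a • t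

omit hp in
/-- The unrestricted specification implies the restricted one. [folklore] -/
theorem IsTopSolver.fr {he : 0 < e}
    {F : (Fin m' → (Fin n → ZMod (p ^ e)) × ZMod (p ^ e)) → (Fin m' → ZMod (p ^ e)) → (Fin n → ZMod (p ^ e))}
    (hF : IsTopSolver a F) : IsTopSolverFR a he F :=
  fun S r _ h => hF S r h

/-- **On the good event the rounding step recovers `s`**, for any solver meeting the restricted
specification. [cite: MicciancioPeikert2012, Thm. 3.1 proof (p. 16)] -/
theorem recoverTop_eq_of_topGood_fr (he : 0 < e) (ha : a ≤ e)
    {F : (Fin m' → (Fin n → ZMod (p ^ e)) × ZMod (p ^ e)) → (Fin m' → ZMod (p ^ e)) → (Fin n → ZMod (p ^ e))}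
    (hF : IsTopSolverFR a he F) (s : Fin n → ZMod (p ^ e)) {S : Fin m' → (Fin n → ZMod (p ^ e)) × ZMod (p ^ e)}
    (hgood : TopGood a he s S) : recoverTop a F S (lowVec a s) = s := by
  set t : Fin n → ZMod (p ^ e) := fun c => quotientAt (s c) a with ht
  have hst : s - lowVec a s = (p : ZMod (p ^ e)) ^ a • t := sub_lowVec_eq a s
  have heqs : ∀ k, topEqs a S (lowVec a s) k = (p : ZMod (p ^ e)) ^ a * ((S k).1 ⬝ᵥ t) := by
    intro k
    obtain ⟨v, hv, hvP⟩ := hgood.2 k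
    have hsplit : (S k).2 - (S k).1 ⬝ᵥ lowVec a s =
        (S k).1 ⬝ᵥ ((p : ZMod (p ^ e)) ^ a • t) + ((S k).2 - (S k).1 ⬝ᵥ s) := by
      rw [← hst, dotProduct_sub]
      ring
    unfold topEqs
    rw [hsplit, hv]
    have h := roundMul_sample_eq (q := p ^ e) (pow_dvd_pow p ha) (S k).1 t rfl hvP
    rw [Nat.cast_pow] at h
    exact h
  obtain ⟨t', ht', hFt'⟩ := hF S (topEqs a S (lowVec a s)) hgood.1 ⟨t, fun k => (heqs k).symm⟩
  have huniq := mul_eq_mul_of_fullRankModP he ha hgood.1 (t := t') (t' := t) fun k => by rw [ht' k, heqs k]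
  unfold recoverTop
  rw [hFt', huniq, ← hst, add_sub_cancel]

end TopFR


end MP12

end LWE

end Literature.Computability.Cryptography

end
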